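import Summits.BirchSwinnertonDyer.Rank1Residual.ManinAdditive.OddDegreeTooth
import Literature.NumberTheory.EllipticCurves.ModularSymbols
import HarnessLib
import HarnessLib.Audit.Tags

/-!
# THE HALF-TRANSLATION `t : τ ↦ τ + ½` DECIDES `deg φ mod 2` — the typed rows E-an-77/77♯/78/79/81/83/84 of an g18
# (MEMO-an §60 «THEOREM A / B / C»; typing ask T-an-23) — cell `bsd-f2-manin` (D-0131 (3) frontier: the Manin
# constant at additive primes)

HONEST FRAMING.  LENS = analytic / period-lattice (seat `bsd-f2-manin-an`, g18; HOME
`run/shared/lean/pub/bsd-f2-manin/MEMO-an.md` §60, HOME/an/MEMO-an-60.md 714013373f1e7cb3).  Source: HOME/an/Sketch-an-g18.lean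
sha16 **46abb1fbb5651cc7** (284 l.; farm rc 0 · 0 errors · 0 warnings · 0 sorries; BC7 7/7 CLEAN
HOME/an/g18-bc7.raw.txt 39e55af04a84d51a), namespace `…Cruxes.ManinOddAtFour.HalfTranslation` ↦
`…ManinAdditive.HalfTranslation`.  §2/§2b rows and §3/§4 edges are copied VERBATIM (bodies byte-identical) with three
changes forced by the tree: (i) the route import `…Theses.ManinLocalTwoThree` is dropped (unused by the rows);
(ii) §3's «verbatim» copies of `blindCurve`, `FourPBlindFamilyOddDegree` (E-an-74) and `FourPBlindFamilyQuarterSymbol`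
(E-an-75) are NOT re-declared — the landed ones (`ShimuraLedger.blindCurve` p624392, `OddDegreeTooth.FourPBlindFamily…`
p624767) are used, so the §3 edge now identifies the LANDED rows; (iii) §1 (E-an-80, the kernel-checked LEMMA
`two_mul_modularSymbol_mem_periodLattice_of_halfFixed` «a `t`-fixed cusp maps to `E[2]`» + its `N = 20` instance) is NOT
in this file: its proof uses `maninLocalTwoThree_modularSymbol_add_half_eq_neg_of_four_dvd` from
`Theorems/ManinLocalTwoThreeAdditiveDyadicTransport.lean`, whose import cone contains the route `Theses` file
(`lint.theses-cone`; a `ManinAdditive/` leaf must stay route-independent) — it lands under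
`Summits/BirchSwinnertonDyer/BirchSwinnertonDyer/Theorems/` by a prover seat (hand-over
HOME/typer/HalfTranslationFixedCuspLemma.handover.lean), unchanged.  Nothing in this file is asserted: the seven
`@[conjecture]` rows are STATEMENTS (THEOREM-candidates with paper proofs in MEMO-an §60.2/§60.5, re-derived by
refuter-1; NOT tree facts), the theorems are kernel-checked edges between them (an's four + refuter-1's RB67.1–67.4).

THE LENS READING (an, Sketch-an-g18 header).  `t = (2 1; 0 2)` normalises `Γ₀(N)` iff `4 ∣ N` (tree:
`ConwayCut.halfTranslate` / `halfTranslateGL`, p618662 — not re-declared here); `f ∣ t = −f` for the newform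
(`a_{2n} = 0`); `t ∞ = ∞`.  Hence `φ ∘ t = −φ` EXACTLY for every `X₀(N)`-parametrisation with `φ(∞) = O`, and
**THEOREM A** (MEMO-an §60.2): for every `w ∈ E[2]`, `#{P ∈ Fix(t) : φ(P) = w} ≡ deg φ (mod 2)`, `Fix(t)` = the cusps
`a/d` with `v₂(d) > v₂(N)/2` ⊔ CM points by `ℤ[i]`/`ℤ[2i]` (pairing off under complex conjugation),
`#Fix(t) = 2g(N) − 4g(N/2) + 2`.  CONSEQUENCE (`w = O`): `deg φ ≡ #{t-fixed cusps c : φ(c) = O} (mod 2)` — a `c`-FREE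
formula for `deg φ mod 2` by finitely many EXACT modular symbols.  At `N = 4p`: `deg φ₀` odd ⟺ `{∞,¼}_f ∉ Λ_f`
(E-an-78) — so E-an-74 ⟺ E-an-75 (§3 edge) —, `p ≡ 3 (4) ⇒ deg` EVEN (E-an-79), **THEOREM B** the cusp hexagon
(E-an-83, `W`-free, no optimality), **THEOREM C = A + B**: `deg φ₀` odd ⟺ `3{∞,0}_f ∉ Λ_f` ⟺ `v₂({∞,0}_f/Ω⁺_f) = −1`
(E-an-84 = es E-es-55's «cusp-zero half-unit»).

BC5 WITNESS (an census, no kit: HOME/an/g18-halftranslate-parity.py d91be815f910bc5d → .out 4ef27656f12412c6 over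
data CUSPIMG-N5000 × Cremona `alldegphi`; HOME/an/g18-fourp-hexagon.py f24feb3b780a1dbe → .out eb6357ea20a24970):
6 160 / 6 160 optimal classes `4 ∣ N ≤ 5 000` (`v₂(N) ∈ [2,8]`), 0 violations; rational-`T` version 305/305; `N = 4p`:
110/110 (10 odd / 100 even, off-diagonal 0), hexagon 110/110.  ENGINE 2 (refuter-1 §R59 §4): (2a) Riemann–Hurwitz
count `2g(N) − 4g(N/2) + 2 = #t-fixed cusps + r*(N)`: 0 mismatches on 5 000 levels `4 ∣ N ≤ 20 000`; (2b) q-series +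
complex-AGM cusp images: law A 105/105 composite squarefree `4M ≤ 1000`; `4p ≤ 2000`: E-78 65/65, E-79 34/34, hexagon
65/65 per clause, E-84 65/65, E-81 7/7.

REFUTER VERDICTS.  refuter-1 §R59 (R-an-33, 2026-08-28T11:30Z; HOME/ref1/R59-ref1-an-g18.md 5b1d6571bd7ffa05; kernel
HOME/ref1-C67-an-g18-audit.lean 0be89a3759100e7b rc 0 · 0/0/0, axioms standard; BC7 summit mode 7/7 CLEAN
R59-PH.raw d2f1b560386ae1c2): **7/7 SURVIVE, 0 KILLED**; F-5: every row quantifies over `ModularParametrizationData`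
(no tree inhabitant — modularity; not vacuous in the bad sense; `IsNewform0` inside `IsNewformOf` kills the free-level
trap); F-6: `hopt` IS load-bearing in 78/79/84 (77♯ is the correct `hopt`-free form); `Squarefree M` by design (a
non-squarefree version must enumerate the classes `a/(4d)`).  refuter-2 R-an-34/placement pending (nearest print:
Yazdani 2011 L2.3–2.5/Rem 1.6, Calegari–Emerton 2009 Thm 1, Stein–Watkins 2004 Thm 2.1).  bears_on:
stmt-BirchSwinnertonDyer-22967 (C2 `ManinOddAtFour`, stub 6 `Rb`, blind-tame half).  PARTITION 0 · beyond-print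
theorem: YES-candidate (THEOREM A, not located in print; refuter-1) · BSD is not proved by this; Manin's conjecture is
not proved by this (THEOREM A decides the parity of `deg φ`, not of `c`).
-/

set_option autoImplicit false

noncomputable section

open scoped MatrixGroups ModularForm
open CongruenceSubgroup
open Literature.NumberTheory.EllipticCurves Literature.NumberTheory.EllipticCurves.ModularForms
open WeierstrassCurve
open Summit.BirchSwinnertonDyer.Rank1Residual.ManinAdditive.ShimuraLedger (blindCurve)
open Summit.BirchSwinnertonDyer.Rank1Residual.ManinAdditive.OddDegreeTooth (FourPBlindFamilyOddDegree
  FourPBlindFamilyQuarterSymbol)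

namespace Summit.BirchSwinnertonDyer.Rank1Residual.ManinAdditive.HalfTranslation

/-! ### §2. Typed candidates (THEOREM A and its `4p` corollaries; nothing asserted; an g18 VERBATIM :91–214) -/

/-- **Candidate E-an-77 `TFixedCuspKernelParity` (THEOREM A, `w = O`, squarefree tame level; `c`-FREE).**
For an `X₀(N)`-optimal `W` (lattice-optimal datum) with `N = 4M`, `M` odd squarefree, the `t`-fixed cusps are the
`[1/(4d)]`, `d ∣ M` (`d = M` is `∞`), and  `deg φ ≡ #{d ∣ M : {∞, 1/(4d)}_f ∈ Λ_f} (mod 2)`.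
BC5: 0 violations on all 1 475 classes with `4 ∥ N ≤ 5 000` (squarefree or not; the non-squarefree `M` use the
full list of `t`-fixed cusp classes) and on all 4 685 with `8 ∣ N ≤ 5 000` (there `Fix(t)` = `t`-fixed cusps only).
Why it might fail: it should not — paper proof MEMO-an §60.2 (Riemann–Hurwitz for `X₀(N) → X₀(N)/t ≅ X₀(N/2)`,
local analysis `e_φ(P)` odd at fixed `P`, CM fixed points pair under complex conjugation); the risk is in the TYPING
(lattice-optimality ⇒ `D.deg` is the optimal degree). [theorem candidate — NOT a tree fact]
REF1 §R59 (R-an-33): **SURVIVES** — THEOREM-candidate, paper proof F-1 re-derived line by line; `d = M` is ALWAYS in `S` (`1/(4M) = 1/N = γ_N ∞`, RB67.1) — intended, «∞ counts once»; `hopt` pins `D.deg` to the optimal degree.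
[cite: Yazdani2011, Lemmas 2.3–2.5 and Remark 1.6 (shape only: the `w_Q`-functional equation of `φ` and the fixed cusp of `w_4`; THEOREM A/B/C are the cell's rows E-an-77…84, NOT located in print — MEMO-an §60, refuter-1 §R59)] -/
@[conjecture]
def TFixedCuspKernelParity : Prop :=
  ∀ (W : WeierstrassCurve ℚ) [W.IsElliptic] {N : ℕ} [NeZero N] (D : ModularParametrizationData W N) (M : ℕ),
    N = 4 * M → Odd M → Squarefree M →
    (∀ z ∈ D.L.lattice, ∃ w ∈ periodLattice D.f, z = D.c * w) →
    ∃ S : Finset ℕ, (∀ d : ℕ, d ∈ S ↔ d ∣ M ∧ modularSymbol D.f (1 / (4 * d) : ℚ) ∈ periodLattice D.f) ∧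
      D.deg % 2 = S.card % 2

/-- **Candidate E-an-77♯ `TFixedCuspKernelParityAnyParam` (THEOREM A for EVERY `X₀(N)`-parametrisation
`φ = uniformize (c ∫_{i∞} f)` of `W`, optimal or not: `φ ∘ t = −φ` holds for all of them).**  `N = 4M`, `M` odd
squarefree: `deg φ ≡ #{d ∣ M : φ([1/(4d)]) = O} (mod 2)`, with `φ([1/(4d)]) = O ⟺ c {∞,1/(4d)}_f ∈ Λ_W`.
No optimality, no minimality hypothesis.  BC5: the optimal rows of §60.4 (6 160 / 6 160); non-optimal members
untested (no cusp-image table for them; D-an-16).  [theorem candidate — NOT a tree fact]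
REF1 §R59: **SURVIVES** — THEOREM-candidate; TRUE for every datum because `f∣t = −f` is about `f` only and `φ_D = [z ↦ cz] ∘ φ_f` with `D.c : ℤ` real commutes with complex conjugation (F-2); the `hopt`-free form of THEOREM A.
[cite: Yazdani2011, Lemmas 2.3–2.5 and Remark 1.6 (shape only: the `w_Q`-functional equation of `φ` and the fixed cusp of `w_4`; THEOREM A/B/C are the cell's rows E-an-77…84, NOT located in print — MEMO-an §60, refuter-1 §R59)] -/
@[conjecture]
def TFixedCuspKernelParityAnyParam : Prop :=
  ∀ (W : WeierstrassCurve ℚ) [W.IsElliptic] {N : ℕ} [NeZero N] (D : ModularParametrizationData W N) (M : ℕ),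
    N = 4 * M → Odd M → Squarefree M →
    ∃ S : Finset ℕ, (∀ d : ℕ, d ∈ S ↔ d ∣ M ∧ (D.c : ℂ) * modularSymbol D.f (1 / (4 * d) : ℚ) ∈ D.L.lattice) ∧
      D.deg % 2 = S.card % 2

/-- **EDGE (kernel-checked): E-an-77♯ ⟹ E-an-77** on lattice-optimal data with `c ≠ 0`
(`c {∞,r}_f ∈ Λ_W = c Λ_f ⟺ {∞,r}_f ∈ Λ_f`). -/
theorem tFixedCuspKernelParity_of_anyParam (h : TFixedCuspKernelParityAnyParam)
    (W : WeierstrassCurve ℚ) [W.IsElliptic] {N : ℕ} [NeZero N] (D : ModularParametrizationData W N) (M : ℕ)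
    (hN : N = 4 * M) (hM : Odd M) (hsq : Squarefree M)
    (hopt : ∀ z ∈ D.L.lattice, ∃ w ∈ periodLattice D.f, z = D.c * w) (hc : D.c ≠ 0) :
    ∃ S : Finset ℕ, (∀ d : ℕ, d ∈ S ↔ d ∣ M ∧ modularSymbol D.f (1 / (4 * d) : ℚ) ∈ periodLattice D.f) ∧
      D.deg % 2 = S.card % 2 := by
  obtain ⟨S, hS, hdeg⟩ := h W D M hN hM hsq
  refine ⟨S, fun d => ?_, hdeg⟩
  rw [hS d]
  refine and_congr_right fun _ => ⟨fun hin => ?_, fun hin => D.smul_periodLattice_le _ hin⟩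
  obtain ⟨w, hw, hcw⟩ := hopt _ hin
  have hc' : (D.c : ℂ) ≠ 0 := by exact_mod_cast hc
  rwa [mul_left_cancel₀ hc' hcw]

/-- **Candidate E-an-78 `FourPDegreeParityIffQuarterSymbol` (THEOREM A at `N = 4p`; `c`-FREE, ONE symbol).**
For an optimal `W` of conductor `4p`, `p` an odd prime:  `deg φ` is odd ⟺ `{∞, 1/4}_f ∉ Λ_f` (⟺ `φ(1/4) ≠ O`
⟺ `φ(1/4)` is a rational point of order 2).  (`Fix(t) = {∞, [1/4]} ⊔ {z_𝔭, z_𝔭̄}` if `p ≡ 1 (4)`, `= {∞, [1/4]}` if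
`p ≡ 3 (4)`; the CM pair contributes evenly to `#φ⁻¹(O) ∩ Fix`.)  BC5: 110/110 classes `N = 4p ≤ 5 000`
(odd & `φ(1/4) ≠ O`: 10 = the blind family; even & `φ(1/4) = O`: 100; off-diagonal: 0).
[theorem candidate — NOT a tree fact]
REF1 §R59: **SURVIVES** — formally a COROLLARY of E-an-77 (RB67.2 `fourPDegreeParityIffQuarterSymbol_of_tFixedCuspKernelParity` below, kernel-checked); 65/65 classes `4p ≤ 2000` by engine 2b (odd ⟺ ord{∞,¼} = 2: 20a1 52a1 116c1 212b1 692a1 916a1 1172a1).  `hopt` is load-bearing (F-6).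
[cite: Yazdani2011, Lemmas 2.3–2.5 and Remark 1.6 (shape only: the `w_Q`-functional equation of `φ` and the fixed cusp of `w_4`; THEOREM A/B/C are the cell's rows E-an-77…84, NOT located in print — MEMO-an §60, refuter-1 §R59)] -/
@[conjecture]
def FourPDegreeParityIffQuarterSymbol : Prop :=
  ∀ (W : WeierstrassCurve ℚ) [W.IsElliptic] {N : ℕ} [NeZero N] (D : ModularParametrizationData W N) (p : ℕ),
    p.Prime → p ≠ 2 → N = 4 * p →
    (∀ z ∈ D.L.lattice, ∃ w ∈ periodLattice D.f, z = D.c * w) →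
    (Odd D.deg ↔ modularSymbol D.f (1 / 4 : ℚ) ∉ periodLattice D.f)

/-- **Candidate E-an-79 `FourPThreeModFourEvenDegree` (corollary of THEOREM A; implied in print for `p > 29` by
Calegari–Emerton Thm 1(3a) + Ivorra 2004, new proof).**  Conductor `4p`, `p ≡ 3 (mod 4)`, optimal ⇒ `deg φ` EVEN
and `{∞, 1/4}_f ∈ Λ_f` (`#Fix(t) = 2 < 4 = #E[2]`).  BC5: 62/62 (`N = 4p ≤ 5 000`, `p ≡ 3 (4)`).
[theorem candidate — NOT a tree fact]
REF1 §R59: **SURVIVES** — conjunct 1 in print for `p > 29` (Calegari–Emerton 2009 Thm 1(3a) + Ivorra 2004), new proof; 34/34 (`p ≡ 3 (4)`, `4p ≤ 2000`, incl. `p = 7, 11, 19, 23`); RB67.3: gives the `p ≡ 3 (4)` half of E-an-78.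
[cite: Yazdani2011, Lemmas 2.3–2.5 and Remark 1.6 (shape only: the `w_Q`-functional equation of `φ` and the fixed cusp of `w_4`; THEOREM A/B/C are the cell's rows E-an-77…84, NOT located in print — MEMO-an §60, refuter-1 §R59)] -/
@[conjecture]
def FourPThreeModFourEvenDegree : Prop :=
  ∀ (W : WeierstrassCurve ℚ) [W.IsElliptic] {N : ℕ} [NeZero N] (D : ModularParametrizationData W N) (p : ℕ),
    p.Prime → p % 4 = 3 → N = 4 * p →
    (∀ z ∈ D.L.lattice, ∃ w ∈ periodLattice D.f, z = D.c * w) →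
    Even D.deg ∧ modularSymbol D.f (1 / 4 : ℚ) ∈ periodLattice D.f

/-- **Candidate E-an-81 `OddDegreeRationalTwoTorsionIsFixedCuspidal` (THEOREM A′ for rational `T`; answers es
A-es-14(a) in the odd-degree regime: BLINDNESS IS IRRELEVANT).**  `N = 4M`, `M` odd squarefree, optimal, `a₁ = a₃ = 0`,
`deg φ` ODD ⇒ every rational 2-torsion point `(e, 0)` is `φ([1/(4d)])` for some `d ∣ M` (so it is CUSPIDAL):
for rational `T` the CM fixed points pair off with equal images, so `#{t-fixed cusps ↦ T} ≡ deg ≡ 1 (mod 2)`.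
Typed through the uniformisation: `φ(1/(4d)) = (e, 0)` iff `c {∞,1/(4d)}_f ∉ Λ_W` and `℘(c {∞,1/(4d)}_f) − b₂/12 = e`.
BC5: 13/13 odd-degree classes with `4 ∣ N ≤ 5 000` (20a1, 24a1, 32a1, 36a1 + 9 family members; every rational `T`
is hit by a `t`-fixed cusp: `24a1`: `1/4 ↦ (−2,0)`, `1/8 ↦ (1,0)`, `1/12 ↦ (2,0)`).  [theorem candidate — NOT a tree fact]
REF1 §R59: **SURVIVES** — THEOREM A′ needs `w` RATIONAL (it is: `e : ℚ`); 7/7 odd-degree `4p` classes `≤ 2000`: the unique rational 2-division root IS `x(φ(¼))`.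
[cite: Yazdani2011, Lemmas 2.3–2.5 and Remark 1.6 (shape only: the `w_Q`-functional equation of `φ` and the fixed cusp of `w_4`; THEOREM A/B/C are the cell's rows E-an-77…84, NOT located in print — MEMO-an §60, refuter-1 §R59)] -/
@[conjecture]
def OddDegreeRationalTwoTorsionIsFixedCuspidal : Prop :=
  ∀ (W : WeierstrassCurve ℚ) [W.IsElliptic] {N : ℕ} [NeZero N] (D : ModularParametrizationData W N) (M : ℕ),
    N = 4 * M → Odd M → Squarefree M →
    (∀ z ∈ D.L.lattice, ∃ w ∈ periodLattice D.f, z = D.c * w) → W.a₁ = 0 → W.a₃ = 0 → Odd D.deg →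
    ∀ e : ℚ, e ^ 3 + W.a₂ * e ^ 2 + W.a₄ * e + W.a₆ = 0 →
      ∃ d : ℕ, d ∣ M ∧ (D.c : ℂ) * modularSymbol D.f (1 / (4 * d) : ℚ) ∉ D.L.lattice ∧
        D.L.weierstrassP ((D.c : ℂ) * modularSymbol D.f (1 / (4 * d) : ℚ)) - (W.baseChange ℂ).b₂ / 12 = (e : ℂ)

/-! ### §2b. The cusp hexagon at `N = 4p` (THEOREMS B/C of MEMO-an §60.5; pure-`f`, `c`-FREE, `W`-FREE) -/

/-- **Candidate E-an-83 `FourPCuspHexagon` (THEOREM B; Atkin–Lehner + half-translation bookkeeping, paper proof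
MEMO-an §60.5).**  For the newform `f` of an elliptic curve of conductor `4p` (`p` odd prime) the six cusps
`{∞, 1/4, 1/p, 1/(2p), 0, 1/2}` of `X₀(4p)` map under `φ_f : X₀(4p) → ℂ/Λ_f` to `{O, T', R, −R, T'+R, −T'−R}` with
`2T' = O` (`1/4 = w_p ∞` is `t`-fixed) and `3R = O` (`1/p = w₄ ∞`; `w₄` fixes the cusp `1/2 = t·0`):  at symbol level
`2{∞,1/4} ∈ Λ_f`, `3{∞,1/p} ∈ Λ_f`, `{∞,0} ≡ {∞,1/4} + {∞,1/p}`, `{∞,1/2} ≡ −{∞,0}`, `{∞,1/(2p)} ≡ −{∞,1/p} (mod Λ_f)`.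
NO optimality, NO parity hypothesis.  BC5 (HOME/an/g18-fourp-hexagon.out eb6357ea20a24970): 110/110 optimal classes
`N = 4p ≤ 5 000` (orders `(ord φ(0), ord φ(1/p))` ∈ {(1,1): 94, (3,3): 6, (2,1): 9, (6,3): 1 = 20a1}; `R ≠ O` at
20a1, 44a1, 92a1, 116b1, 236b1, 404b1, 2636a1 — all with `3 ∣ #E₀(ℚ)_tors`).  [theorem candidate — NOT a tree fact]
REF1 §R59: **SURVIVES** — THEOREM-candidate, folklore-level (Atkin–Lehner bookkeeping on `f`, Yazdani 2011 L2.4/Rem 1.6); 65/65 each clause; EXTRA (F-3, engine 29/29): `a_p = +1 ⇒ R = O`, so `R ≠ O ⇒ a_p = −1 ∧ λ₄ = −1 ∧ ε = +1 ∧` rational cuspidal 3-torsion; RB67.4: under the hexagon `2{∞,0} ∈ Λ_f ⟺ {∞,1/p} ∈ Λ_f`.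
[cite: Yazdani2011, Lemmas 2.3–2.5 and Remark 1.6 (shape only: the `w_Q`-functional equation of `φ` and the fixed cusp of `w_4`; THEOREM A/B/C are the cell's rows E-an-77…84, NOT located in print — MEMO-an §60, refuter-1 §R59)] -/
@[conjecture]
def FourPCuspHexagon : Prop :=
  ∀ (W : WeierstrassCurve ℚ) [W.IsElliptic] {N : ℕ} [NeZero N] (D : ModularParametrizationData W N) (p : ℕ),
    p.Prime → p ≠ 2 → N = 4 * p →
    (2 : ℂ) * modularSymbol D.f (1 / 4 : ℚ) ∈ periodLattice D.f ∧
    (3 : ℂ) * modularSymbol D.f (1 / p : ℚ) ∈ periodLattice D.f ∧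
    modularSymbol D.f 0 - modularSymbol D.f (1 / 4 : ℚ) - modularSymbol D.f (1 / p : ℚ) ∈ periodLattice D.f ∧
    modularSymbol D.f (1 / 2 : ℚ) + modularSymbol D.f 0 ∈ periodLattice D.f ∧
    modularSymbol D.f (1 / (2 * p) : ℚ) + modularSymbol D.f (1 / p : ℚ) ∈ periodLattice D.f

/-- **Candidate E-an-84 `FourPCuspZeroParity` (THEOREM C = A + B; answers es A-es-15 / imc A-imc-18 at theorem level
on paper).**  Optimal conductor `4p`:  `deg φ` odd ⟺ `3{∞,0}_f ∉ Λ_f` ⟺ `ord φ₀(0) ∈ {2, 6}` ⟺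
`v₂({∞,0}_f / Ω⁺_f) = −1` (es E-es-55, the «cusp-zero half-unit») — so es's and an's readings of «the one bit» are
the SAME bit for every optimal curve of conductor `4p`, and `L(E₀,1) ≠ 0` for every odd-degree one.
BC5 (g18-fourp-hexagon.out): `[ord φ₀(0) even] ⟺ deg odd` 110/110.  [theorem candidate — NOT a tree fact]
REF1 §R59: **SURVIVES** — = E-an-83 + E-an-78 (edge `fourPCuspZeroParity_of_hexagon_of_quarter`, kernel-checked); 65/65; `hopt` load-bearing (F-6).
[cite: Yazdani2011, Lemmas 2.3–2.5 and Remark 1.6 (shape only: the `w_Q`-functional equation of `φ` and the fixed cusp of `w_4`; THEOREM A/B/C are the cell's rows E-an-77…84, NOT located in print — MEMO-an §60, refuter-1 §R59)] -/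
@[conjecture]
def FourPCuspZeroParity : Prop :=
  ∀ (W : WeierstrassCurve ℚ) [W.IsElliptic] {N : ℕ} [NeZero N] (D : ModularParametrizationData W N) (p : ℕ),
    p.Prime → p ≠ 2 → N = 4 * p →
    (∀ z ∈ D.L.lattice, ∃ w ∈ periodLattice D.f, z = D.c * w) →
    (Odd D.deg ↔ (3 : ℂ) * modularSymbol D.f 0 ∉ periodLattice D.f)

/-- **EDGE (kernel-checked): hexagon + THEOREM A at `4p` ⟹ THEOREM C** (lattice arithmetic:
`3{∞,0} − {∞,1/4} = 3({∞,0} − {∞,1/4} − {∞,1/p}) + 2{∞,1/4} + 3{∞,1/p} ∈ Λ_f`). -/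
theorem fourPCuspZeroParity_of_hexagon_of_quarter (hB : FourPCuspHexagon)
    (hA : FourPDegreeParityIffQuarterSymbol) : FourPCuspZeroParity := by
  intro W _ N _ D p hp hp2 hN hopt
  obtain ⟨h2, h3, h0, -, -⟩ := hB W D p hp hp2 hN
  have key : (3 : ℂ) * modularSymbol D.f 0 - modularSymbol D.f (1 / 4 : ℚ) ∈ periodLattice D.f := by
    have h0' := (periodLattice D.f).nsmul_mem h0 3
    have := (periodLattice D.f).add_mem ((periodLattice D.f).add_mem h0' h2) h3
    convert this using 1
    simp only [nsmul_eq_mul, Nat.cast_ofNat]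
    ring
  rw [hA W D p hp hp2 hN hopt]
  constructor
  · intro hq h3in
    exact hq (by simpa using (periodLattice D.f).sub_mem h3in key)
  · intro h3out hqin
    exact h3out (by simpa using (periodLattice D.f).add_mem key hqin)

/-! ### §3. The edge to §59: THEOREM A at `4p` makes E-an-74 and E-an-75 ONE statement (kernel-checked; an g18
VERBATIM over the LANDED rows `OddDegreeTooth.FourPBlindFamilyOddDegree` / `…QuarterSymbol` and `ShimuraLedger.blindCurve`) -/

/-- `p = m² + 4` with `m ≡ 1 (mod 4)` is odd, hence `≠ 2`. -/
theorem level_prime_ne_two {m : ℤ} {p : ℕ} (hm : m % 4 = 1) (hp : (p : ℤ) = m ^ 2 + 4) : p ≠ 2 := by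
  obtain ⟨k, hk⟩ : ∃ k : ℤ, m = 4 * k + 1 := ⟨m / 4, by omega⟩
  have hodd : Odd (p : ℤ) := ⟨8 * k ^ 2 + 4 * k + 2, by rw [hp, hk]; ring⟩
  have hp2 : p % 2 = 1 := Nat.odd_iff.mp (by exact_mod_cast hodd)
  omega

/-- **EDGE (kernel-checked): THEOREM A at `4p` ⟹ (E-an-74 ⟺ E-an-75).**  The modular-degree parity law on the
blind family and the quarter-symbol law are the SAME statement; g17's one-way `OddDegreeForcesQuarterSymbol` is
superseded. -/
theorem fourPBlindFamily_oddDegree_iff_quarterSymbol (hA : FourPDegreeParityIffQuarterSymbol) :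
    FourPBlindFamilyOddDegree ↔ FourPBlindFamilyQuarterSymbol := by
  constructor
  · intro hodd m p _ _ _ D hm hp hpp hopt
    exact (hA (blindCurve m) D p hpp (level_prime_ne_two hm hp) rfl hopt).mp (hodd m p D hm hp hpp hopt)
  · intro hq m p _ _ _ D hm hp hpp hopt
    exact (hA (blindCurve m) D p hpp (level_prime_ne_two hm hp) rfl hopt).mpr (hq m p D hm hp hpp hopt)

/-- **EDGE (kernel-checked): THEOREM A at `4p` + E-an-79 are consistent with Calegari–Emerton on the family side:
`p ≡ 3 (4)` levels carry no odd degree.**  (Trivial bookkeeping: E-an-79 gives `Even`, which excludes `Odd`.) -/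
theorem not_odd_deg_of_three_mod_four (h79 : FourPThreeModFourEvenDegree)
    (W : WeierstrassCurve ℚ) [W.IsElliptic] {N : ℕ} [NeZero N] (D : ModularParametrizationData W N) (p : ℕ)
    (hp : p.Prime) (hp3 : p % 4 = 3) (hN : N = 4 * p)
    (hopt : ∀ z ∈ D.L.lattice, ∃ w ∈ periodLattice D.f, z = D.c * w) : ¬ Odd D.deg :=
  fun hodd => (Nat.not_even_iff_odd.mpr hodd) (h79 W D p hp hp3 hN hopt).1

/-! ### §4. Sanity (`decide` / `norm_num`): the fixed-point bookkeeping of MEMO-an §60 at small levels -/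

/-- `γ₂₀ (1/4) = 3/4`: numerically `(−29/4 + 8)/(−40/4 + 11) = 3/4`. -/
example : ((-29 : ℚ) * (1 / 4) + 8) / ((-40 : ℚ) * (1 / 4) + 11) = 1 / 4 + 1 / 2 := by norm_num

/-- The general witness `(1 − 6M, (3M+1)/2; −8M, 2M+1)` has determinant `1` (checked at `M = 5, 13, 29, 53`). -/
example : (1 - 6 * 5 : ℤ) * (2 * 5 + 1) - (3 * 5 + 1) / 2 * (-8 * 5) = 1 ∧
    (1 - 6 * 13 : ℤ) * (2 * 13 + 1) - (3 * 13 + 1) / 2 * (-8 * 13) = 1 ∧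
    (1 - 6 * 29 : ℤ) * (2 * 29 + 1) - (3 * 29 + 1) / 2 * (-8 * 29) = 1 ∧
    (1 - 6 * 53 : ℤ) * (2 * 53 + 1) - (3 * 53 + 1) / 2 * (-8 * 53) = 1 := by decide

/-- `#Fix(t) = 2 g(N) − 4 g(N/2) + 2` at `N = 20, 44, 52, 100`: `(g(N), g(N/2)) = (1,0), (4,2), (5,2), (7,2)` give
`4, 2, 4, 8` = (fixed cusps) + (CM points) = `2+2, 2+0, 2+2, 6+2`. -/
example : 2 * 1 - 4 * 0 + 2 = 2 + 2 ∧ 2 * 4 - 4 * 2 + 2 = 2 + 0 ∧ 2 * 5 - 4 * 2 + 2 = 2 + 2 ∧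
    2 * 7 - 4 * 2 + 2 = 6 + 2 := by decide

/-! ### §5. refuter-1's kernel read-back edges (REF1 §R59 RB67.1–67.4, HOME/ref1-C67-an-g18-audit.lean 0be89a3759100e7b,
VERBATIM up to names) -/

/-- `γ_N = (1 0; N 1)` (refuter-1 RB67). -/
def levelMatrix (N : ℕ) : SL(2, ℤ) :=
  ⟨!![1, 0; (N : ℤ), 1], by rw [Matrix.det_fin_two_of]; ring⟩

/-- `γ_N ∈ Γ₀(N)`. -/
theorem levelMatrix_mem (N : ℕ) : levelMatrix N ∈ Gamma0 N :=
  Gamma0_mem.mpr (by simp [levelMatrix])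

/-- `γ_N` as an element of `Γ₀(N)`. -/
def levelElt (N : ℕ) : Gamma0 N := ⟨levelMatrix N, levelMatrix_mem N⟩

/-- Entry `(0,0)` of `γ_N`. -/
@[simp] theorem levelElt_apply_00 (N : ℕ) : ((levelElt N : SL(2, ℤ)) 0 0 : ℤ) = 1 := rfl
/-- Entry `(1,0)` of `γ_N`. -/
@[simp] theorem levelElt_apply_10 (N : ℕ) : ((levelElt N : SL(2, ℤ)) 1 0 : ℤ) = N := rfl

/-- **RB67.1** `{∞, 1/N}_f ∈ Λ_f`: the cusp `1/N = γ_N ∞` is `Γ₀(N)`-equivalent to `∞` — so in E-an-77/77♯ the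
divisor `d = M` is always in `S` («∞ counts once»). (refuter-1, PROVED.) -/
theorem levelInv_mem {N : ℕ} [NeZero N] (f : CuspForm (Gamma0 N) 2) :
    modularSymbol f (1 / (N : ℚ)) ∈ periodLattice f := by
  have h := cuspSymbol_mem_periodLattice f (levelElt N)
  have hN : N ≠ 0 := NeZero.ne N
  simpa [cuspSymbol, hN] using h

/-- **RB67.2** E-an-77 (THEOREM A, squarefree tame level) ⟹ E-an-78 (THEOREM A at `4p`): `S = {1, p}` if
`{∞,¼} ∈ Λ_f`, else `{p}`. (refuter-1, PROVED; E-an-78 is formally a corollary of E-an-77.) -/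
theorem fourPDegreeParityIffQuarterSymbol_of_tFixedCuspKernelParity (h77 : TFixedCuspKernelParity) :
    FourPDegreeParityIffQuarterSymbol := by
  intro W _ N _ D p hp hp2 hN hopt
  obtain ⟨S, hS, hdeg⟩ := h77 W D p hN (hp.odd_of_ne_two hp2) hp.prime.squarefree hopt
  have hpN : modularSymbol D.f (1 / (4 * (p : ℚ))) ∈ periodLattice D.f := by
    have h := levelInv_mem D.f
    have hc : (1 / (N : ℚ)) = 1 / (4 * (p : ℚ)) := by rw [hN]; push_cast; ring
    rwa [hc] at h
  by_cases hq : modularSymbol D.f (1 / 4 : ℚ) ∈ periodLattice D.f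
  · have hS' : S = {1, p} := by
      ext d
      rw [hS, Finset.mem_insert, Finset.mem_singleton, Nat.dvd_prime hp]
      constructor
      · rintro ⟨h, -⟩; exact h
      · rintro (rfl | rfl)
        · exact ⟨Or.inl rfl, by simpa using hq⟩
        · exact ⟨Or.inr rfl, hpN⟩
    rw [hS', Finset.card_pair hp.one_lt.ne] at hdeg
    refine ⟨fun hodd => ?_, fun hnot => absurd hq hnot⟩
    have := Nat.odd_iff.mp hodd; omega
  · have hS' : S = {p} := by
      ext d
      rw [hS, Finset.mem_singleton, Nat.dvd_prime hp]
      constructor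
      · rintro ⟨rfl | rfl, hmem⟩
        · exact absurd (by simpa using hmem) hq
        · rfl
      · rintro rfl; exact ⟨Or.inr rfl, hpN⟩
    rw [hS', Finset.card_singleton] at hdeg
    exact ⟨fun _ => hq, fun _ => Nat.odd_iff.mpr (by omega)⟩

/-- **RB67.3** E-an-79 ⟹ the `p ≡ 3 (mod 4)` instances of E-an-78 (there both sides of the `iff` are false).
(refuter-1, PROVED.) -/
theorem fourPDegreeParityIff_on_three_mod_four_of_evenDegree (h79 : FourPThreeModFourEvenDegree)
    (W : WeierstrassCurve ℚ) [W.IsElliptic] {N : ℕ} [NeZero N] (D : ModularParametrizationData W N) (p : ℕ)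
    (hp : p.Prime) (hp3 : p % 4 = 3) (hN : N = 4 * p)
    (hopt : ∀ z ∈ D.L.lattice, ∃ w ∈ periodLattice D.f, z = D.c * w) :
    (Odd D.deg ↔ modularSymbol D.f (1 / 4 : ℚ) ∉ periodLattice D.f) := by
  obtain ⟨heven, hin⟩ := h79 W D p hp hp3 hN hopt
  exact ⟨fun hodd => absurd heven (Nat.not_even_iff_odd.mpr hodd), fun hnot => absurd hin hnot⟩

/-- **RB67.4** Under the hexagon (E-an-83): `2{∞,0}_f ∈ Λ_f ⟺ {∞,1/p}_f ∈ Λ_f`, i.e. `φ(0) ∈ E[2] ⟺ R = O`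
(`2{∞,0} = 2({∞,0} − T' − R) + 2T' + 2R` and `R = 3R − 2R`) — the lattice identity behind the census dichotomy
`(ord φ(0), ord R) ∈ {(1,1),(2,1)} ⊔ {(3,3),(6,3)}`. (refuter-1, PROVED.) -/
theorem two_mul_zeroSymbol_mem_iff_of_hexagon (hB : FourPCuspHexagon)
    (W : WeierstrassCurve ℚ) [W.IsElliptic] {N : ℕ} [NeZero N] (D : ModularParametrizationData W N) (p : ℕ)
    (hp : p.Prime) (hp2 : p ≠ 2) (hN : N = 4 * p) :
    ((2 : ℂ) * modularSymbol D.f 0 ∈ periodLattice D.f ↔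
      modularSymbol D.f (1 / p : ℚ) ∈ periodLattice D.f) := by
  obtain ⟨h2, h3, h0, -, -⟩ := hB W D p hp hp2 hN
  constructor
  · intro hZ
    have h2R : (2 : ℂ) * modularSymbol D.f (1 / p : ℚ) ∈ periodLattice D.f := by
      have := (periodLattice D.f).sub_mem ((periodLattice D.f).sub_mem hZ ((periodLattice D.f).nsmul_mem h0 2)) h2
      convert this using 1
      simp only [nsmul_eq_mul, Nat.cast_ofNat]
      ring
    have := (periodLattice D.f).sub_mem h3 h2R
    convert this using 1
    ring
  · intro hR
    have := (periodLattice D.f).add_mem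
      ((periodLattice D.f).add_mem ((periodLattice D.f).nsmul_mem h0 2) h2) ((periodLattice D.f).nsmul_mem hR 2)
    convert this using 1
    simp only [nsmul_eq_mul, Nat.cast_ofNat]
    ring

end Summit.BirchSwinnertonDyer.Rank1Residual.ManinAdditive.HalfTranslation

end
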